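import Summits.KontsevichZagierPeriods.KontsevichZagierPeriods.Theorems.RootDecompRelativeModAbsoluteRegKernelPairLeOneP02

/-!
(LANDED by the census seat decomp-kz-census-1 g7 `--supports stmt-KontsevichZagierPeriods-30572`; source lens-3 g9 landing package #2, critic decomp-kz-crit-1 g2 CLEARED §14–§17; generic docstrings added where the source had none.)

# `RegKernelPairDegOne` — the transcendence input for TWO monomials (route `RootDecompRelativeModAbsolute`,
towards the rung `k + k' = 2` of support item stmt-KontsevichZagierPeriods-30572) — PROVED · part 4/5

Cell `decomp-kz`, lens 3 (decomp-kz-lens-3 g9).  After the reduction of part 3 (smooth full-measure locus,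
defect `≡ 0`), two regularised log/arctan monomials give at every point a relation
`c₁(x) L₁(x) + c₂(x) L₂(x) = c₀(x)` with `ℚ`-semialgebraic continuous coefficients and
`Lᵢ ∈ {log wᵢ, arctan dᵢ}`.  Part 4: Baker for two logarithms in scalar form (`CircleBaker.two_term`,
`two_logs`, `two_arctans`, `log_arctan`: the constant term vanishes; a non-trivial relation has a RATIONAL
coefficient ratio; mixed log/arctan relations are trivial).  Part 5: the function form —
`exists_irrational_isAlgebraic_btwn`, `eqOn_const_of_rational_at_algebraic` (a continuous
`ℚ`-semialgebraic function of one variable with rational values at all algebraic points of a ball is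
constant there: non-interior points of `ℚ`-semialgebraic subsets of the line are algebraic),
`uniform_ratio_two_logs` / `uniform_ratio_two_arctans` (locally `c₁ = q c₂` and `log w₂ = −q log w₁`
with a CONSTANT rational `q` — a uniform multiplicative relation `w₂^n = w₁^{−p}`), `log_arctan_rigid`.
What remains for `k + k' = 2` is the KZ-realisation of the uniform relation by fibrewise
substitution/splitting moves (calculus side).

Source: `HOME/decomp-kz-lens-3/g9/RelativeModAbsoluteDegOneBands.lean` §15 (sha256 fe1756d100ec418f, 6003 l; farm
rc 0 / 0 warn / 0 sorry; `#print axioms uniform_ratio_two_logs` = propext, Classical.choice, Quot.sound), verbatim,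
in the namespace of the landed `RegFoldingDegOne` chain.  No `sorry`; standard axioms.
References: Baker 1975 (Transcendental Number Theory) Thm 2.1 [tree: `baker_holds`]; Bochnak–Coste–Roy 1998 §2.2, §2.9.
-/

noncomputable section

open Set MeasureTheory Filter Topology
open scoped BigOperators
open Literature.NumberTheory.Transcendental Literature.ModelTheory.ExponentialFields

namespace Summit.KontsevichZagierPeriods.RootDecompRelativeModAbsolute.Rung30571

namespace RegularisedLogLayer

-- PRIVATE copies (these CircleBaker lemmas are private in part 1 because their landed twins live in farm-unbuilt modules):
namespace CircleBaker

/-- `isAlgebraic_ofReal` (PRIVATE: landed twin elsewhere, dedup.landed): auxiliary theorem of the first transcendence rung `k + k′ ≤ 1` of `RegKernelPairDegOne` (stmt-30572), lens-3 g9 §14 — see the module docstring; verbatim from the lens file. -/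
private theorem isAlgebraic_ofReal {x : ℝ} (hx : IsAlgebraic ℚ x) : IsAlgebraic ℚ (x : ℂ) :=
  (isAlgebraic_algebraMap_iff (A := ℂ) Complex.ofReal_injective).mpr hx

/-- `isAlgebraic_I` (PRIVATE: landed twin elsewhere, dedup.landed): auxiliary theorem of the first transcendence rung `k + k′ ≤ 1` of `RegKernelPairDegOne` (stmt-30572), lens-3 g9 §14 — see the module docstring; verbatim from the lens file. -/
private theorem isAlgebraic_I : IsAlgebraic ℚ Complex.I :=
  IsAlgebraic.of_pow two_pos (by rw [Complex.I_sq]; exact isAlgebraic_one.neg)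

/-- `exp (log w) = w` is algebraic for a positive real algebraic `w`. [folklore] -/
private theorem isAlgebraic_cexp_log {w : ℝ} (hw : IsAlgebraic ℚ w) (hpos : 0 < w) :
    IsAlgebraic ℚ (Complex.exp ((Real.log w : ℝ) : ℂ)) := by
  rw [← Complex.ofReal_exp, Real.exp_log hpos]
  exact isAlgebraic_ofReal hw

end CircleBaker

namespace CircleBaker

/-- **Baker for two logarithms.** If `β₁ l₁ + β₂ l₂ = β₀` with `e^{l₁}, e^{l₂}, β₀, β₁, β₂`
algebraic, then `β₀ = 0`; and if `l₁ ≠ 0`, `β₂ ≠ 0` then `β₁ = q β₂` for a RATIONAL `q`.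
[Baker1975 Thm 2.1; folklore] -/
theorem two_term {l₁ l₂ β₁ β₂ β₀ : ℂ} (h₁ : IsAlgebraic ℚ (Complex.exp l₁))
    (h₂ : IsAlgebraic ℚ (Complex.exp l₂)) (hb₁ : IsAlgebraic ℚ β₁) (hb₂ : IsAlgebraic ℚ β₂)
    (hb₀ : IsAlgebraic ℚ β₀) (hsum : β₁ * l₁ + β₂ * l₂ = β₀) :
    β₀ = 0 ∧ (l₁ ≠ 0 → β₂ ≠ 0 → ∃ q : ℚ, β₁ = q * β₂) := by
  have halg : ∀ i, IsAlgebraic ℚ (Complex.exp (![l₁, l₂] i)) := fun i => by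
    fin_cases i
    · simpa using h₁
    · simpa using h₂
  have hβ : ∀ i, IsAlgebraic ℚ (![β₁, β₂] i) := fun i => by
    fin_cases i
    · simpa using hb₁
    · simpa using hb₂
  have hB := baker_complex (ι := Fin 2) ![l₁, l₂] ![β₁, β₂] β₀ halg hβ hb₀
    (by simpa [Fin.sum_univ_two] using hsum)
  refine ⟨hB.1, fun hl₁ hβ₂ => ?_⟩
  have hnot : ¬ LinearIndependent ℚ ![β₁, β₂] := fun hli => hl₁ (by simpa using hB.2 hli 0)
  rw [LinearIndependent.pair_iff] at hnot
  push Not at hnot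
  obtain ⟨s, t, hst, hst0⟩ := hnot
  have hst' : (s : ℂ) * β₁ + (t : ℂ) * β₂ = 0 := by simpa [Rat.smul_def] using hst
  have hs : s ≠ 0 := by
    intro hs
    subst hs
    have ht : (t : ℂ) * β₂ = 0 := by simpa using hst'
    rcases mul_eq_zero.1 ht with ht | hb
    · exact hst0 rfl (by exact_mod_cast ht)
    · exact hβ₂ hb
  have hsC : (s : ℂ) ≠ 0 := by exact_mod_cast hs
  refine ⟨-t / s, ?_⟩
  push_cast
  field_simp
  linear_combination hst'

/-- Two real logarithms: `c₁ log w₁ + c₂ log w₂ = c₀` with everything algebraic forces `c₀ = 0`,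
and `c₁ = q c₂` (`q ∈ ℚ`) as soon as `w₁ ≠ 1`, `c₂ ≠ 0`. [Baker1975 Thm 2.1; folklore] -/
theorem two_logs {w₁ w₂ c₁ c₂ c₀ : ℝ} (hw₁ : 0 < w₁) (hw₂ : 0 < w₂) (a₁ : IsAlgebraic ℚ w₁)
    (a₂ : IsAlgebraic ℚ w₂) (b₁ : IsAlgebraic ℚ c₁) (b₂ : IsAlgebraic ℚ c₂) (b₀ : IsAlgebraic ℚ c₀)
    (hsum : c₁ * Real.log w₁ + c₂ * Real.log w₂ = c₀) :
    c₀ = 0 ∧ (w₁ ≠ 1 → c₂ ≠ 0 → ∃ q : ℚ, c₁ = q * c₂) := by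
  have h := two_term (isAlgebraic_cexp_log a₁ hw₁) (isAlgebraic_cexp_log a₂ hw₂)
    (isAlgebraic_ofReal b₁) (isAlgebraic_ofReal b₂) (isAlgebraic_ofReal b₀) (by exact_mod_cast hsum)
  refine ⟨by exact_mod_cast h.1, fun hne hc₂ => ?_⟩
  have hl₁ : ((Real.log w₁ : ℝ) : ℂ) ≠ 0 := by
    rw [Ne, Complex.ofReal_eq_zero]
    exact Real.log_ne_zero_of_pos_of_ne_one hw₁ hne
  obtain ⟨q, hq⟩ := h.2 hl₁ (by exact_mod_cast hc₂)
  exact ⟨q, by exact_mod_cast hq⟩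

/-- Two arctangents (two algebraic points of the unit circle): `c₁ arctan d₁ + c₂ arctan d₂ = c₀`
with everything algebraic forces `c₀ = 0`, and `c₁ = q c₂` (`q ∈ ℚ`) as soon as `d₁ ≠ 0`, `c₂ ≠ 0`.
[Baker1975 Thm 2.1; folklore] -/
theorem two_arctans {d₁ d₂ c₁ c₂ c₀ : ℝ} (a₁ : IsAlgebraic ℚ d₁) (a₂ : IsAlgebraic ℚ d₂)
    (b₁ : IsAlgebraic ℚ c₁) (b₂ : IsAlgebraic ℚ c₂) (b₀ : IsAlgebraic ℚ c₀)
    (hsum : c₁ * Real.arctan d₁ + c₂ * Real.arctan d₂ = c₀) :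
    c₀ = 0 ∧ (d₁ ≠ 0 → c₂ ≠ 0 → ∃ q : ℚ, c₁ = q * c₂) := by
  have hsum' : (-(c₁ : ℂ) * Complex.I) * (((Real.arctan d₁ : ℝ) : ℂ) * Complex.I) +
      (-(c₂ : ℂ) * Complex.I) * (((Real.arctan d₂ : ℝ) : ℂ) * Complex.I) = c₀ := by
    have h0 : (c₁ : ℂ) * Real.arctan d₁ + c₂ * Real.arctan d₂ = c₀ := by exact_mod_cast hsum
    have hI : Complex.I * Complex.I = -1 := Complex.I_mul_I
    linear_combination h0 - ((c₁ : ℂ) * Real.arctan d₁ + c₂ * Real.arctan d₂) * hI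
  have h := two_term (isAlgebraic_cexp_arctan_mul_I a₁) (isAlgebraic_cexp_arctan_mul_I a₂)
    (((isAlgebraic_ofReal b₁).neg).mul isAlgebraic_I) (((isAlgebraic_ofReal b₂).neg).mul isAlgebraic_I)
    (isAlgebraic_ofReal b₀) hsum'
  refine ⟨by exact_mod_cast h.1, fun hne hc₂ => ?_⟩
  have hl₁ : ((Real.arctan d₁ : ℝ) : ℂ) * Complex.I ≠ 0 := by
    refine mul_ne_zero ?_ Complex.I_ne_zero
    rw [Ne, Complex.ofReal_eq_zero]
    exact fun h0 => hne (Real.arctan_eq_zero_iff.mp h0)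
  have hβ₂ : -(c₂ : ℂ) * Complex.I ≠ 0 :=
    mul_ne_zero (neg_ne_zero.2 (by exact_mod_cast hc₂)) Complex.I_ne_zero
  obtain ⟨q, hq⟩ := h.2 hl₁ hβ₂
  refine ⟨q, ?_⟩
  have hC : (c₁ : ℂ) = q * c₂ := by
    apply mul_right_cancel₀ Complex.I_ne_zero
    linear_combination -hq
  exact_mod_cast hC

/-- A mixed relation `c₁ log w + c₂ arctan d = c₀` (a positive real algebraic number against an
algebraic point of the unit circle) forces `c₀ = 0`, and is trivial: `w = 1 ∧ d = 0` whenever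
`c₁ c₂ ≠ 0`. [Baker1975 Thm 2.1; folklore] -/
theorem log_arctan {w d c₁ c₂ c₀ : ℝ} (hw : 0 < w) (aw : IsAlgebraic ℚ w) (ad : IsAlgebraic ℚ d)
    (b₁ : IsAlgebraic ℚ c₁) (b₂ : IsAlgebraic ℚ c₂) (b₀ : IsAlgebraic ℚ c₀)
    (hsum : c₁ * Real.log w + c₂ * Real.arctan d = c₀) :
    c₀ = 0 ∧ (c₁ ≠ 0 → c₂ ≠ 0 → w = 1 ∧ d = 0) := by
  have hsum' : (c₁ : ℂ) * ((Real.log w : ℝ) : ℂ) +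
      (-(c₂ : ℂ) * Complex.I) * (((Real.arctan d : ℝ) : ℂ) * Complex.I) = c₀ := by
    have h0 : (c₁ : ℂ) * Real.log w + c₂ * Real.arctan d = c₀ := by exact_mod_cast hsum
    have hI : Complex.I * Complex.I = -1 := Complex.I_mul_I
    linear_combination h0 - ((c₂ : ℂ) * Real.arctan d) * hI
  have h := two_term (isAlgebraic_cexp_log aw hw) (isAlgebraic_cexp_arctan_mul_I ad)
    (isAlgebraic_ofReal b₁) (((isAlgebraic_ofReal b₂).neg).mul isAlgebraic_I)
    (isAlgebraic_ofReal b₀) hsum'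
  have hc₀ : c₀ = 0 := by exact_mod_cast h.1
  refine ⟨hc₀, fun hc₁ hc₂ => ?_⟩
  -- `w = 1`: otherwise the coefficient ratio `c₁ / (−c₂ i)` would be rational, i.e. real = imaginary
  have hw1 : w = 1 := by
    by_contra hne
    have hl₁ : ((Real.log w : ℝ) : ℂ) ≠ 0 := by
      rw [Ne, Complex.ofReal_eq_zero]
      exact Real.log_ne_zero_of_pos_of_ne_one hw hne
    have hβ₂ : -(c₂ : ℂ) * Complex.I ≠ 0 :=
      mul_ne_zero (neg_ne_zero.2 (by exact_mod_cast hc₂)) Complex.I_ne_zero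
    obtain ⟨q, hq⟩ := h.2 hl₁ hβ₂
    have hre := congrArg Complex.re hq
    simp at hre
    exact hc₁ hre
  refine ⟨hw1, ?_⟩
  have h0 : c₂ * Real.arctan d = 0 := by
    have := hsum
    rw [hw1, Real.log_one, mul_zero, zero_add, hc₀] at this
    exact this
  rcases mul_eq_zero.1 h0 with h0 | h0
  · exact absurd h0 hc₂
  · exact Real.arctan_eq_zero_iff.mp h0

end CircleBaker

end RegularisedLogLayer

end Summit.KontsevichZagierPeriods.RootDecompRelativeModAbsolute.Rung30571

end
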